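import Summits.BirchSwinnertonDyer.BirchSwinnertonDyer.Theorems.ThetaPartnerAtTwoSignedKatoUpToAtTwoKatoBKSocketKZ
import Literature.NumberTheory.EllipticCurves.CyclotomicLayerTatePairing
import HarnessLib

/-!
# Route `ThetaPartnerAtTwo` (TP2), crux K3 `SignedKatoDivisibilityUpToAtTwo` (stmt-BirchSwinnertonDyer-20308) / K3P′
# (stmt-BirchSwinnertonDyer-25631), line `colemanrat` v14.1 — CORE_KZ IN LITERATURE VOCABULARY (`CORE_KZ_Lit ⟹ CORE_KZ`)

Lead prover `bsd-wall-tp2-p2x` g8 (cell `bsd-wall`). The registered PUB stub `stub_katoValuesKZTwo` = CORE_KZ (hypothesis `hKZ` of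
`KatoBK.corePairChiPrim_of_coreKZ_of_bricks`, w3 g8 p636266) speaks the ROUTE's language at three places: (P3) pins the layer pairing
`pair` to `SignedKatoOffTwo.LayerPairing.layerPairingPk … (weilTowerPk W) …` (Summits), and the (KZ) clause reads the formal logarithm
through `BallEval.ptLogΩ` / `genFibΩ` / `toLoc` / `LocalTwo.baseChange_twoAdicModel` and the chosen `2`-adic tower
`PadicCyclotomicTower.zeta` (all Summits-side). A NAMED Literature fact (Kato Thm. 12.5 (1) read on the local Tate pairing through
Bloch–Kato) cannot import them. This file displays **CORE_KZ_Lit** — the same mathematics in Literature + Mathlib names only: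

* the pairing value is an element `t : ℤ₂` given through ITS RESIDUES `CyclotomicLayer.tatePairingPk W κ v n k` (w3 g5's Literature
  port of THE `T₂W`-adic layer Tate pairings; no auxiliary `pair`, no (P1)/(P2));
* the logarithm is `∑ᵢ logᵢ · z(Q₀)ⁱ` for the formal logarithm `(W ⊗ ℚ₂).formalLog` of the (globally minimal) equation `W` and Mathlib's
  parameter `z = −x/y` (`WeierstrassCurve.Affine.Point.zCoord`), summed in `ℚ̄₂ = PadicAlgCl 2`;
* the formal-group condition is the carrier condition of `FormalGroupChart.kernel` («`|x(Q₀)| > 1`»);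
* the `2`-adic frame is ANY COHERENT tower of embeddings `e_k : ℚ(ζ_{2^k}) → ℚ̄₂` (`e_{k+1}(ζ_{2^{k+1}})² = e_k(ζ_{2^k})`) with Galois
  lifts `τ` acting on `e_k(ζ_{2^k})` by `b`-th powers (no chosen tower `zeta`; coherence is NOT idle: with the norm relations (C1) and the
  projection formula for `tatePairingPk` the clause ties `e_{n+2}(x_{n+2})` across levels, so a level-wise incoherent frame would make the
  displayed statement false — the analogue of w5 g2's `ιC`-pin); the idle binders of CORE_KZ (`¬CM`, `r_an = 0`, `a₂ = 0`, `γ`, `ϖ`, the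
  Pollack pair, `ι`) are dropped;

and proves `KatoBK.coreKZ_of_coreKZLit : CORE_KZ_Lit → CORE_KZ` (unfold `ptLogΩ`, transport `z(Q)` and the kernel condition along
`toLoc`, identify the two integral models, recover `pair n x Q` from its residues by `PadicInt.ext_of_toZModPow`). So the line's
displayed PUB stub can be re-keyed to CORE_KZ_Lit, a statement a Literature typer can file verbatim against [Kato 2004, Thm. 12.5 (1)]
+ [Bloch–Kato 1990, §3] (the dual exponential phrased by local Tate duality: `⟨x, ∂Q⟩ = Tr(log_ω Q · exp*_ω x)`, Kato LNM 1553 II §1;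
Kobayashi 2003 (8.25)). HONEST FRAMING: one conditional theorem (hypothesis displayed) + three plumbing lemmas; no definition, no named
fact, no instance, no `sorry`; closes no item; K3/K3P′ NOT settled; BSD is NOT proved by any of this.
-/

set_option autoImplicit false
-- the Theorems namespace of this sub repeats the summit name by design (D-0017 nested layout)
set_option linter.dupNamespace false

noncomputable section

set_option backward.isDefEq.respectTransparency false

open scoped Classical MatrixGroups ModularForm NumberField TensorProduct

open CongruenceSubgroup WeierstrassCurve Field IsDedekindDomain NumberField
  Literature.NumberTheory.GaloisRepresentations
  Literature.NumberTheory.EllipticCurves Literature.NumberTheory.EllipticCurves.ModularForms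
  Literature.NumberTheory.EllipticCurves.Module Literature.NumberTheory.EllipticCurves.Rank1Residual
  Literature.NumberTheory.EllipticCurves.Kobayashi2003 Literature.NumberTheory.EllipticCurves.Kato2004
  Literature.NumberTheory.EllipticCurves.Kato2004.EulerSystemValues Literature.NumberTheory.EllipticCurves.GreenbergSelmer
  Literature.NumberTheory.EllipticCurves.Sprung2012
  Literature.NumberTheory.EllipticCurves.FormalGroupChart
  ZpExtension Summit.BirchSwinnertonDyer.Rank1Residual.Supersingular
  Summit.BirchSwinnertonDyer.Rank1Residual.Additive Summit.BirchSwinnertonDyer.Rank1Residual.Additive.PadicCyclotomicTower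
  Summit.BirchSwinnertonDyer.Rank1Residual.Additive.BallEval
  Summit.BirchSwinnertonDyer.BirchSwinnertonDyer.Theorems.SignedKatoOffTwo.LocalTwo

namespace Summit.BirchSwinnertonDyer.BirchSwinnertonDyer.Theorems.SignedKatoOffTwo.KatoBK

/-! ## §1 Plumbing: `z(Q)` and `ΛΩ(Q)` along `toLoc` -/

/-- `ptCast` (transport of points along an equality of Weierstrass equations) does not change Mathlib's parameter `z = −x/y`. [folklore] -/
theorem zCoord_ptCast_symm {F : Type*} [Field F] {V₁ V₂ : WeierstrassCurve F} (h : V₁ = V₂) (P : V₂.toAffine.Point) :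
    ((ptCast h).symm P).zCoord = P.zCoord := by
  subst h; rfl

/-- The generic fibre of the `2`-adic integral model of a globally minimal `W` IS `W ⊗ ℚ₂`:
`((integralModelInt W) ⊗ ℤ₂) ⊗ ℚ₂ = W ⊗ ℚ₂`. [folklore] -/
theorem map_integralModelInt_twoAdic (W : WeierstrassCurve ℚ) [W.IsGloballyMinimal] :
    ((integralModelInt W).map (Int.castRingHom ℤ_[2])).map (PadicInt.Coe.ringHom (p := 2)) = W.map (algebraMap ℚ ℚ_[2]) := by
  conv_rhs => rw [← map_integralModelInt W]
  rw [map_map, map_map]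
  exact congrArg _ (RingHom.ext_int _ _)

/-- **`ΛΩ` read through `toLoc` is the formal logarithm of `W ⊗ ℚ₂` at `z(Q₀)`**: for a point `Q₀ ∈ E(ℚ̄₂)` of `W`,
`ptLogΩ 2 M ((toLoc h).symm Q₀) = ∑ᵢ logᵢ(W ⊗ ℚ₂) · z(Q₀)ⁱ` (`M` = the `2`-adic integral model). [cite: SilvermanAEC2009, IV.5 and Prop. VII.2.2] -/
theorem ptLogΩ_toLoc_symm_eq (W : WeierstrassCurve ℚ) [W.IsElliptic] [W.IsGloballyMinimal] (Q₀ : localPoints W ℚ_[2]) :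
    ptLogΩ 2 ((integralModelInt W).map (Int.castRingHom ℤ_[2]))
        ((toLoc ((genFibΩ_eq_baseChange ((integralModelInt W).map (Int.castRingHom ℤ_[2]))).trans
          (baseChange_twoAdicModel W))).symm Q₀) =
      ∑' i : ℕ, algebraMap ℚ_[2] (PadicAlgCl 2) (PowerSeries.coeff i (W.map (algebraMap ℚ ℚ_[2])).formalLog) *
        (WeierstrassCurve.Affine.Point.zCoord (show (W.baseChange (AlgebraicClosure ℚ_[2])).toAffine.Point from Q₀)) ^ i := by
  have hz : WeierstrassCurve.Affine.Point.zCoord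
      ((toLoc ((genFibΩ_eq_baseChange ((integralModelInt W).map (Int.castRingHom ℤ_[2]))).trans
        (baseChange_twoAdicModel W))).symm Q₀) =
      WeierstrassCurve.Affine.Point.zCoord (show (W.baseChange (AlgebraicClosure ℚ_[2])).toAffine.Point from Q₀) :=
    zCoord_ptCast_symm _ _
  rw [ptLogΩ, bLogΩ, hz, logQ, map_integralModelInt_twoAdic]

/-! ## §2 CORE_KZ_Lit ⟹ CORE_KZ -/

/-- **CORE_KZ in Literature vocabulary implies the registered CORE_KZ.** The hypothesis `hlit` (CORE_KZ_Lit) is Kato's zeta-value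
package at `p = 2` — (C1)–(C5) `ZetaBody` at the standard complex embeddings with ONE `(κK, ΛK)` — together with the Λ-free
Bloch–Kato clause for the DISPLAYED classes: for every formal layer-`n` point `Q₀`, the `T₂W`-adic layer Tate pairing value
`t = ⟨Cor z_{2^{n+2}}, Q₀⟩_n ∈ ℤ₂`, given through its residues `CyclotomicLayer.tatePairingPk`, satisfies
`t = Σ_{b ∈ (ℤ/2^{n+2})ˣ} τ_b (log_{W⊗ℚ₂}(z(Q₀)) · e_{n+2}(x_{n+2})) = Tr_{ℚ₂(μ_{2^{n+2}})/ℚ₂}(log_ω Q₀ · x_{n+2})`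
[Kato Thm. 12.5 (1) (`exp*(z) = x·ω`) read through Bloch–Kato (3.10.1)/(3.11): `⟨x, ∂Q⟩ = Tr(log_ω Q · exp*_ω x)`]. The conclusion is
CORE_KZ VERBATIM (hypothesis `hKZ` of `corePairChiPrim_of_coreKZ_of_bricks`). Proof: instantiate; (P3) + `PadicInt.ext_of_toZModPow`
recover `pair n x Q = t`; `ptLogΩ_toLoc_symm_eq` and `toLoc_symm_mem_kernel_iff` translate the logarithm and the formal-group condition.
[cite: Kato2004Asterisque, Thm. 12.5 (1) (p. 222), Ex. 13.3 (p. 225)] [cite: BlochKato1990, §3 (3.10.1), (3.11)]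
[cite: Kobayashi2003, (8.23), Prop. 8.25 (p. 18)] -/
theorem coreKZ_of_coreKZLit
    (hlit :
      ∀ (v : HeightOneSpectrum (𝓞 ℚ)), ((2 : ℕ) : 𝓞 ℚ) ∈ v.asIdeal →
      ∀ (W : WeierstrassCurve ℚ) [W.IsElliptic] [W.IsGloballyMinimal], GoodSS W 2 →
        ∀ (κ : ZpExtension ℚ 2) (hκ : κ.IsCyclotomic),
          ∀ [NeZero (W.conductorNorm ℤ)] (f : CuspForm (Gamma0 (W.conductorNorm ℤ)) 2), IsNewformOf W f →
          ∀ [ContinuousSMul ℤ_[2] (W.tateModule 2)] [Module.Free ℤ_[2] (W.tateModule 2)]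
            [Module.Finite ℤ_[2] (W.tateModule 2)],
          ∀ (Φ : AlgebraicClosure ℚ_[2] ≃ₐ[ℚ] AlgebraicClosure (v.adicCompletion ℚ)) (φ : ℚ_[2] ≃+* v.adicCompletion ℚ),
            (∀ y : ℚ_[2], Φ (algebraMap ℚ_[2] (AlgebraicClosure ℚ_[2]) y) =
              algebraMap (v.adicCompletion ℚ) (AlgebraicClosure (v.adicCompletion ℚ)) (φ y)) →
          ∀ (e : ∀ k : ℕ, CyclotomicField (cycLevel 2 k ∅) ℚ →ₐ[ℚ] PadicAlgCl 2)
            (τ : ∀ m : ℕ, ZMod (2 ^ m) → Field.absoluteGaloisGroup ℚ_[2]),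
            -- the `2`-adic frame: a COHERENT tower `e_{k+1}(ζ_{2^{k+1}})² = e_k(ζ_{2^k})` with Galois lifts `τ_a : e_k(ζ) ↦ e_k(ζ)^a`
            (∀ k : ℕ, e (k + 1) (IsCyclotomicExtension.zeta (cycLevel 2 (k + 1) ∅) ℚ (CyclotomicField (cycLevel 2 (k + 1) ∅) ℚ)) ^ 2 =
              e k (IsCyclotomicExtension.zeta (cycLevel 2 k ∅) ℚ (CyclotomicField (cycLevel 2 k ∅) ℚ))) →
            (∀ (k : ℕ) (a : ZMod (2 ^ k)), IsUnit a →
              τ k a • e k (IsCyclotomicExtension.zeta (cycLevel 2 k ∅) ℚ (CyclotomicField (cycLevel 2 k ∅) ℚ)) =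
                e k (IsCyclotomicExtension.zeta (cycLevel 2 k ∅) ℚ (CyclotomicField (cycLevel 2 k ∅) ℚ)) ^ a.val) →
          -- the complex frame: the STANDARD embeddings at the pure levels (Kato (5.7.1))
          ∀ (ιC : (m : ℕ) → (CyclotomicField m ℚ →+* ℂ)),
          (∀ k : ℕ, ιC (cycLevel 2 k ∅) (IsCyclotomicExtension.zeta (cycLevel 2 k ∅) ℚ (CyclotomicField (cycLevel 2 k ∅) ℚ)) =
            Complex.exp (2 * Real.pi * Complex.I / (cycLevel 2 k ∅ : ℕ))) →
          ∃ κK : ℝ, κK ≠ 0 ∧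
          ∃ ΛK : ∀ (k : ℕ) (r : Finset (HeightOneSpectrum (𝓞 ℚ))),
              H1 (tateRep W 2) (cycSubgroup 2 k r) →ₗ[ℤ_[2]] ℚ_[2] ⊗[ℚ] CyclotomicField (cycLevel 2 k r) ℚ,
            ∀ (c d a : ℤ) (A : ℕ), 0 < A → Int.gcd c (6 * 2 * A) = 1 → Int.gcd d (6 * 2 * W.conductorNorm ℤ) = 1 →
              ∃ (z : ∀ (k : ℕ) (r : (cyclotomicLevelsRat 2 (badPlaces c d A (W.conductorNorm ℤ))).Ideals),
                    H1 (tateRep W 2) ((cyclotomicLevelsRat 2 (badPlaces c d A (W.conductorNorm ℤ))).level k r.1))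
                (x : ∀ (k : ℕ) (r : (cyclotomicLevelsRat 2 (badPlaces c d A (W.conductorNorm ℤ))).Ideals),
                    CyclotomicField (cycLevel 2 k r.1) ℚ),
                ZetaBody W 2 f ιC κK ΛK c d a A z x ∧
                ∀ (n : ℕ) (Q₀ : localPoints W ℚ_[2])
                  (hQv : WeierstrassCurve.Affine.Point.map (W' := W)
                      (Φ : AlgebraicClosure ℚ_[2] →ₐ[ℚ] AlgebraicClosure (v.adicCompletion ℚ))
                      (show (W.baseChange (AlgebraicClosure ℚ_[2])).toAffine.Point from Q₀) ∈
                    localLayerPointsOfEmb κ (closureEmb (K := ℚ) (v.adicCompletion ℚ)) W n),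
                  (∀ (X Y : AlgebraicClosure ℚ_[2]) (hXY : (W.baseChange (AlgebraicClosure ℚ_[2])).toAffine.Nonsingular X Y),
                      (show (W.baseChange (AlgebraicClosure ℚ_[2])).toAffine.Point from Q₀) = .some X Y hXY → 1 < Valued.v X) →
                  ∃ t : ℤ_[2],
                    (∀ k : ℕ, CyclotomicLayer.tatePairingPk W κ v n k
                        (levelToLayerTwo W hκ (∅ : Set (HeightOneSpectrum (𝓞 ℚ))) n
                          (z (n + 2) (cyclotomicLevelsRat 2 (badPlaces c d A (W.conductorNorm ℤ))).idealOne))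
                        ⟨_, hQv⟩ = PadicInt.toZModPow k t) ∧
                    algebraMap ℚ_[2] (PadicAlgCl 2) (t : ℚ_[2]) =
                      ∑ b : (ZMod (2 ^ (n + 2)))ˣ, τ (n + 2) (b : ZMod (2 ^ (n + 2))) •
                        ((∑' i : ℕ, algebraMap ℚ_[2] (PadicAlgCl 2) (PowerSeries.coeff i (W.map (algebraMap ℚ ℚ_[2])).formalLog) *
                            (WeierstrassCurve.Affine.Point.zCoord
                              (show (W.baseChange (AlgebraicClosure ℚ_[2])).toAffine.Point from Q₀)) ^ i) *
                          e (n + 2) (x (n + 2) (cyclotomicLevelsRat 2 (badPlaces c d A (W.conductorNorm ℤ))).idealOne))) :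
      ∀ (v : HeightOneSpectrum (𝓞 ℚ)), ((2 : ℕ) : 𝓞 ℚ) ∈ v.asIdeal →
      ∀ (W : WeierstrassCurve ℚ) [W.IsElliptic] [W.IsGloballyMinimal],
        ¬ W.HasCM → W.analyticRank = 0 → GoodSS W 2 → W.frobeniusTrace 2 = 0 →
        ∀ (κ : ZpExtension ℚ 2) (γ : Field.absoluteGaloisGroup ℚ) (hκ : κ.IsCyclotomic),
          κ.IsTopGenerator γ → IsCyclotomicVariable 2 γ →
          ∀ [NeZero (W.conductorNorm ℤ)] (f : CuspForm (Gamma0 (W.conductorNorm ℤ)) 2),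
            IsNewformOf W f → ∀ (ϖ : ℚ), (ϖ : ℝ) * W.realPeriodRat = plusPeriod f →
          ∀ (Lplus Lminus : IwasawaAlgebra 2), IsPollackPair f 2 Lplus Lminus →
          ∀ [ContinuousSMul ℤ_[2] (W.tateModule 2)] [Module.Free ℤ_[2] (W.tateModule 2)]
            [Module.Finite ℤ_[2] (W.tateModule 2)],
          ∀ (pair : ∀ n : ℕ, H1 (tateRep W 2) (κ.layerSubgroup n) →ₗ[ℤ_[2]]
              (localLayerPointsOfEmb κ (closureEmb (K := ℚ) (v.adicCompletion ℚ)) W n →+ ℤ_[2])),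
            (∀ (n : ℕ) (x : H1 (tateRep W 2) (κ.layerSubgroup (n + 1))) (Q : localPoints W (v.adicCompletion ℚ))
              (hQ : Q ∈ localLayerPointsOfEmb κ (closureEmb (K := ℚ) (v.adicCompletion ℚ)) W n),
              pair n (layerCores (tateRep W 2) κ n x) ⟨Q, hQ⟩ =
                pair (n + 1) x ⟨Q, localLayerPointsOfEmb_mono κ (closureEmb (K := ℚ) (v.adicCompletion ℚ)) W (Nat.le_succ n) hQ⟩) →
            (∀ (n : ℕ) (g : absoluteGaloisGroup (v.adicCompletion ℚ)) (y : H1 (tateRep W 2) (κ.layerSubgroup n))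
              (Q : localPoints W (v.adicCompletion ℚ))
              (hQ : Q ∈ localLayerPointsOfEmb κ (closureEmb (K := ℚ) (v.adicCompletion ℚ)) W n),
              pair n (conjMap (tateRep W 2).toTopRep (κ.layerSubgroup n) (resGalOfEmb (closureEmb (K := ℚ) (v.adicCompletion ℚ)) g) 1 y)
                ⟨g • Q, smul_mem_localLayerPointsOfEmb κ (closureEmb (K := ℚ) (v.adicCompletion ℚ)) W n g hQ⟩ = pair n y ⟨Q, hQ⟩) →
            (∀ (n k : ℕ) (x : H1 (tateRep W 2) (κ.layerSubgroup n))
              (Q : localLayerPointsOfEmb κ (closureEmb (K := ℚ) (v.adicCompletion ℚ)) W n),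
              PadicInt.toZModPow k (pair n x Q) =
                LayerPairing.layerPairingPk W κ v (LayerPairing.weilTowerPk W) (LayerPairing.weilTowerPk_pow W)
                  (LayerPairing.weilTowerPk_add_left W) (LayerPairing.weilTowerPk_add_right W) (LayerPairing.weilTowerPk_smul W)
                  n k x Q) →
          ∀ (Φ : AlgebraicClosure ℚ_[2] ≃ₐ[ℚ] AlgebraicClosure (v.adicCompletion ℚ)) (φ : ℚ_[2] ≃+* v.adicCompletion ℚ),
            (∀ y : ℚ_[2], Φ (algebraMap ℚ_[2] (AlgebraicClosure ℚ_[2]) y) =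
              algebraMap (v.adicCompletion ℚ) (AlgebraicClosure (v.adicCompletion ℚ)) (φ y)) →
          ∀ (ι : AlgebraicClosure ℚ →ₐ[ℚ] AlgebraicClosure ℚ_[2]),
            (∀ z, closureEmb (K := ℚ) (v.adicCompletion ℚ) z = Φ (ι z)) →
          ∀ (e : ∀ k : ℕ, CyclotomicField (cycLevel 2 k ∅) ℚ →ₐ[ℚ] PadicAlgCl 2),
            (∀ k, e k (IsCyclotomicExtension.zeta (cycLevel 2 k ∅) ℚ (CyclotomicField (cycLevel 2 k ∅) ℚ)) = zeta 2 k) →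
          ∀ (τ : ∀ m : ℕ, ZMod (2 ^ m) → Field.absoluteGaloisGroup ℚ_[2]),
            (∀ (m : ℕ) (a : ZMod (2 ^ m)), IsUnit a → τ m a • zeta 2 m = zeta 2 m ^ a.val) →
          ∀ (ιC : (m : ℕ) → (CyclotomicField m ℚ →+* ℂ)),
          (∀ k : ℕ, ιC (cycLevel 2 k ∅) (IsCyclotomicExtension.zeta (cycLevel 2 k ∅) ℚ (CyclotomicField (cycLevel 2 k ∅) ℚ)) =
            Complex.exp (2 * Real.pi * Complex.I / (cycLevel 2 k ∅ : ℕ))) →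
          ∃ κK : ℝ, κK ≠ 0 ∧
          ∃ ΛK : ∀ (k : ℕ) (r : Finset (HeightOneSpectrum (𝓞 ℚ))),
              H1 (tateRep W 2) (cycSubgroup 2 k r) →ₗ[ℤ_[2]] ℚ_[2] ⊗[ℚ] CyclotomicField (cycLevel 2 k r) ℚ,
            ∀ (c d a : ℤ) (A : ℕ), 0 < A → Int.gcd c (6 * 2 * A) = 1 → Int.gcd d (6 * 2 * W.conductorNorm ℤ) = 1 →
              ∃ (z : ∀ (k : ℕ) (r : (cyclotomicLevelsRat 2 (badPlaces c d A (W.conductorNorm ℤ))).Ideals),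
                    H1 (tateRep W 2) ((cyclotomicLevelsRat 2 (badPlaces c d A (W.conductorNorm ℤ))).level k r.1))
                (x : ∀ (k : ℕ) (r : (cyclotomicLevelsRat 2 (badPlaces c d A (W.conductorNorm ℤ))).Ideals),
                    CyclotomicField (cycLevel 2 k r.1) ℚ),
                ZetaBody W 2 f ιC κK ΛK c d a A z x ∧
                (haveI := isIntegral_genFib_baseChange 2 ((integralModelInt W).map (Int.castRingHom ℤ_[2]))
                 ∀ (n : ℕ) (Q₀ : localPoints W ℚ_[2])
                  (hQv : WeierstrassCurve.Affine.Point.map (W' := W)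
                      (Φ : AlgebraicClosure ℚ_[2] →ₐ[ℚ] AlgebraicClosure (v.adicCompletion ℚ))
                      (show (W.baseChange (AlgebraicClosure ℚ_[2])).toAffine.Point from Q₀) ∈
                    localLayerPointsOfEmb κ (closureEmb (K := ℚ) (v.adicCompletion ℚ)) W n),
                  (toLoc ((genFibΩ_eq_baseChange ((integralModelInt W).map (Int.castRingHom ℤ_[2]))).trans
                    (baseChange_twoAdicModel W))).symm Q₀ ∈
                    kernel (Valued.v (R := PadicAlgCl 2)) (genFibΩ 2 ((integralModelInt W).map (Int.castRingHom ℤ_[2]))) →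
                  algebraMap ℚ_[2] (PadicAlgCl 2)
                      ((pair n (levelToLayerTwo W hκ (∅ : Set (HeightOneSpectrum (𝓞 ℚ))) n
                          (z (n + 2) (cyclotomicLevelsRat 2 (badPlaces c d A (W.conductorNorm ℤ))).idealOne))
                        ⟨_, hQv⟩ : ℤ_[2]) : ℚ_[2]) =
                    ∑ b : (ZMod (2 ^ (n + 2)))ˣ, τ (n + 2) (b : ZMod (2 ^ (n + 2))) •
                      (ptLogΩ 2 ((integralModelInt W).map (Int.castRingHom ℤ_[2]))
                          ((toLoc ((genFibΩ_eq_baseChange ((integralModelInt W).map (Int.castRingHom ℤ_[2]))).trans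
                            (baseChange_twoAdicModel W))).symm Q₀) *
                        e (n + 2) (x (n + 2) (cyclotomicLevelsRat 2 (badPlaces c d A (W.conductorNorm ℤ))).idealOne))) := by
  intro v hv W _ _ hcm hr hss ha κ γ hκ hγ hvar _ f hf ϖ hϖ Lplus Lminus hPol _ _ _ pair hP1 hP2 hP3 Φ φ hΦφ ι hι e he τ hτ ιC hιC
  -- the `e`/`τ` compatibility of CORE_KZ_Lit from the pinned tower `zeta 2`
  have heτ : ∀ (k : ℕ) (a : ZMod (2 ^ k)), IsUnit a →
      τ k a • e k (IsCyclotomicExtension.zeta (cycLevel 2 k ∅) ℚ (CyclotomicField (cycLevel 2 k ∅) ℚ)) =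
        e k (IsCyclotomicExtension.zeta (cycLevel 2 k ∅) ℚ (CyclotomicField (cycLevel 2 k ∅) ℚ)) ^ a.val := by
    intro k a ha; rw [he k]; exact hτ k a ha
  have hcoh : ∀ k : ℕ, e (k + 1) (IsCyclotomicExtension.zeta (cycLevel 2 (k + 1) ∅) ℚ (CyclotomicField (cycLevel 2 (k + 1) ∅) ℚ)) ^ 2 =
      e k (IsCyclotomicExtension.zeta (cycLevel 2 k ∅) ℚ (CyclotomicField (cycLevel 2 k ∅) ℚ)) := by
    intro k; rw [he, he]; exact zeta_succ_pow 2 k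
  obtain ⟨κK, hκK, ΛK, hmain⟩ := hlit v hv W hss κ hκ f hf Φ φ hΦφ e τ hcoh heτ ιC hιC
  refine ⟨κK, hκK, ΛK, fun c d a A hA hc hd ↦ ?_⟩
  obtain ⟨z, x, hbody, hKZ⟩ := hmain c d a A hA hc hd
  refine ⟨z, x, hbody, ?_⟩
  intro n Q₀ hQv hker
  haveI := isIntegral_genFib_baseChange 2 ((integralModelInt W).map (Int.castRingHom ℤ_[2]))
  -- the formal-group condition, transported along `toLoc`
  have hker' := (toLoc_symm_mem_kernel_iff (W := W)
    ((genFibΩ_eq_baseChange ((integralModelInt W).map (Int.castRingHom ℤ_[2]))).trans (baseChange_twoAdicModel W)) Q₀).mp hker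
  obtain ⟨t, ht, htval⟩ := hKZ n Q₀ hQv hker'
  -- `pair n x Q = t` from the residues (P3)
  have hpair : pair n (levelToLayerTwo W hκ (∅ : Set (HeightOneSpectrum (𝓞 ℚ))) n
      (z (n + 2) (cyclotomicLevelsRat 2 (badPlaces c d A (W.conductorNorm ℤ))).idealOne)) ⟨_, hQv⟩ = t := by
    refine PadicInt.ext_of_toZModPow.mp fun k ↦ ?_
    rw [hP3, ← ht k]
    rfl
  rw [hpair, htval, ptLogΩ_toLoc_symm_eq]

end Summit.BirchSwinnertonDyer.BirchSwinnertonDyer.Theorems.SignedKatoOffTwo.KatoBK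

end
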